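import Mathlib
import HarnessLib
import Summits.HubbardSuperconductivity.HubbardSuperconductivity.Theorems.KLProgrammeCutCurrencyFactorisation

/-!
# Route `KLProgramme` — ENGINE (stmt-HubbardSuperconductivity-20437 `KLRegimeEngineV17F2`), located #25 «(b)-PLAIN-UV-TAIL», cure (α),
# E1 item (i) towards the WEIGHTED rows: THE FIRST-MOMENT (tree-weight) FACTORISATION `Σ_t (Σ_i d(t_i,t_q))|T(t)| ≤ 8·Mom·Mass³/N`
# (cell gate-hubbard-kl, seat hubbard-kl-k3c2-p2 g35; sequel of ✓-farm `…CutCurrencyFactorisation`)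

Binder #6 weighs the pinned plain currency by `klScaleWt_n = 1 + Λ_n·diam`; for the (spatially local) bare vertex the diameter is a TIME diameter, bounded by
`2·Σ_i d(τ_{t_i}, τ_{t_q})` with `d` the torus distance.  This file proves the model-free time-sum inequality behind the weighted tree-level datum: for any leg
weight `c` supported in `4|n′| < 2M` (as in `klct_pinnedTimeSum_le_legMass_pow_four`) and the cyclic index distance `d_N(a) = min(a, N − a)` on `ℤ_N`, `N = 2M`,

  `Σ_{t : t_q = y₀} (Σ_i d_N(t_i − y₀)) · |Σ_{n allowed} (∏ c(n_i)) ∏ e^{−is_iω_{n_i}τ_{t_i}}| ≤ 8 · N⁻¹ · Mom(c) · Mass(c)³`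

(**`klct_pinnedTimeSum_firstMoment_le`**), `Mass(c) = Σ_j |ĉ(j)|`, `Mom(c) = Σ_j d_N(j)|ĉ(j)|`, `ĉ(j) = Σ_v c(v)e^{−2πivj/N}`: the modular factorisation of
`…Factorisation` at a common auxiliary time `σ`, the torus triangle inequality `d_N(t_i − y₀) ≤ d_N(±(t_i+σ)) + d_N(±(y₀+σ))`, and pinned product sums with one
weighted leg.  With `…FirstMomentBound` (`Mom/N ≲ β⁻¹·O(1)` in index units, i.e. the physical moment `(β/N)·Mom/N = O(1)`) and `Mass/N ≤ 15` this is the β/M-uniform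
first-moment datum; the `klScaleWt`/`gridLabelDist` plumbing and the `∀ τ′` extension are the weighted-row file's.
§1 the cyclic distance (`d_N(−a) = d_N(a)`, subadditivity); §2 leg sums of an arbitrary function of the leg variable; §3 the theorem.
No definition; nothing asserts any row, (b), (C), K3, U₀, the window or superconductivity.
References: BGM 2006 §2.3 (2.17), §3 (tree expansion weights) [cite: BenfattoGiulianiMastropietro2006].
-/

noncomputable section

namespace Summit.HubbardSuperconductivity.HubbardSuperconductivity.Theorems.KLRegimeSplit

set_option linter.dupNamespace false -- summit = problem name (single-conjunct summit), D-0017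

open Finset Literature.MathematicalPhysics.QuantumLattice Literature.Probability.LatticeModels GrassmannAlgebra

variable {M : ℕ} [NeZero M]

/-! ## §1 The cyclic index distance `d_N(a) = min(a, N − a)` on `ℤ_{2M}` -/

/-- `d_N(−a) = d_N(a)`. -/
theorem klct_cycDist_neg (a : ImagTimeIdx M) :
    min ((((-a : ImagTimeIdx M)) : ℕ) : ℝ) (((2 * M : ℕ) : ℝ) - (((-a : ImagTimeIdx M)) : ℕ)) = min ((a : ℕ) : ℝ) (((2 * M : ℕ) : ℝ) - (a : ℕ)) := by
  have hMne := NeZero.ne M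
  have ha := a.isLt
  rcases Nat.eq_zero_or_pos (a : ℕ) with h0 | hpos
  · have hneg : (((-a : ImagTimeIdx M)) : ℕ) = 0 := by rw [Fin.val_neg', h0, Nat.sub_zero, Nat.mod_self]
    rw [hneg, h0]
  · have hneg : (((-a : ImagTimeIdx M)) : ℕ) = 2 * M - (a : ℕ) := by
      rw [Fin.val_neg']; exact Nat.mod_eq_of_lt (by omega)
    rw [hneg, Nat.cast_sub ha.le, min_comm]
    congr 1
    ring

omit [NeZero M] in
/-- **Subadditivity**: `d_N(a + b) ≤ d_N(a) + d_N(b)`. -/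
theorem klct_cycDist_add_le (a b : ImagTimeIdx M) :
    min ((((a + b : ImagTimeIdx M)) : ℕ) : ℝ) (((2 * M : ℕ) : ℝ) - (((a + b : ImagTimeIdx M)) : ℕ)) ≤
      min ((a : ℕ) : ℝ) (((2 * M : ℕ) : ℝ) - (a : ℕ)) + min ((b : ℕ) : ℝ) (((2 * M : ℕ) : ℝ) - (b : ℕ)) := by
  have ha := a.isLt
  have hb := b.isLt
  have hab := (a + b : ImagTimeIdx M).isLt
  -- the value of the sum: `a + b` or `a + b − N`
  have hval : (((a + b : ImagTimeIdx M)) : ℕ) = (a : ℕ) + (b : ℕ) ∨ (((a + b : ImagTimeIdx M)) : ℕ) + 2 * M = (a : ℕ) + (b : ℕ) := by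
    rw [Fin.val_add]
    rcases Nat.lt_or_ge ((a : ℕ) + (b : ℕ)) (2 * M) with h | h
    · left; exact Nat.mod_eq_of_lt h
    · right; rw [Nat.mod_eq_sub_mod h, Nat.mod_eq_of_lt (by omega)]; omega
  -- pass to naturals
  have hnat : min ((((a + b : ImagTimeIdx M)) : ℕ)) (2 * M - (((a + b : ImagTimeIdx M)) : ℕ)) ≤
      min (a : ℕ) (2 * M - (a : ℕ)) + min (b : ℕ) (2 * M - (b : ℕ)) := by
    rcases hval with h | h <;> omega
  have hcast : ∀ x : ImagTimeIdx M, min ((x : ℕ) : ℝ) (((2 * M : ℕ) : ℝ) - (x : ℕ)) = ((min (x : ℕ) (2 * M - (x : ℕ)) : ℕ) : ℝ) := by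
    intro x; rw [Nat.cast_min, Nat.cast_sub x.isLt.le]
  rw [hcast, hcast, hcast]
  exact_mod_cast hnat

/-- **The torus triangle inequality through a common auxiliary time**: `d_N(x − y) ≤ d_N(±(x + σ)) + d_N(±(y + σ))` (any signs). -/
theorem klct_cycDist_sub_le (x y σ : ImagTimeIdx M) (e e' : Fin 2) :
    min ((((x - y : ImagTimeIdx M)) : ℕ) : ℝ) (((2 * M : ℕ) : ℝ) - (((x - y : ImagTimeIdx M)) : ℕ)) ≤
      min (((((if e = 0 then x + σ else -(x + σ) : ImagTimeIdx M))) : ℕ) : ℝ) (((2 * M : ℕ) : ℝ) - ((((if e = 0 then x + σ else -(x + σ) : ImagTimeIdx M))) : ℕ)) +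
      min (((((if e' = 0 then y + σ else -(y + σ) : ImagTimeIdx M))) : ℕ) : ℝ) (((2 * M : ℕ) : ℝ) - ((((if e' = 0 then y + σ else -(y + σ) : ImagTimeIdx M))) : ℕ)) := by
  have hxy : (x - y : ImagTimeIdx M) = (x + σ) + (-(y + σ)) := by abel
  have h1 := klct_cycDist_add_le (x + σ) (-(y + σ))
  rw [← hxy, klct_cycDist_neg] at h1
  have hx : min (((((if e = 0 then x + σ else -(x + σ) : ImagTimeIdx M))) : ℕ) : ℝ) (((2 * M : ℕ) : ℝ) - ((((if e = 0 then x + σ else -(x + σ) : ImagTimeIdx M))) : ℕ)) =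
      min ((((x + σ : ImagTimeIdx M)) : ℕ) : ℝ) (((2 * M : ℕ) : ℝ) - (((x + σ : ImagTimeIdx M)) : ℕ)) := by
    split_ifs
    · rfl
    · exact klct_cycDist_neg _
  have hy : min (((((if e' = 0 then y + σ else -(y + σ) : ImagTimeIdx M))) : ℕ) : ℝ) (((2 * M : ℕ) : ℝ) - ((((if e' = 0 then y + σ else -(y + σ) : ImagTimeIdx M))) : ℕ)) =
      min ((((y + σ : ImagTimeIdx M)) : ℕ) : ℝ) (((2 * M : ℕ) : ℝ) - (((y + σ : ImagTimeIdx M)) : ℕ)) := by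
    split_ifs
    · rfl
    · exact klct_cycDist_neg _
  rw [hx, hy]
  exact h1

omit [NeZero M] in
/-- `0 ≤ d_N`. -/
theorem klct_cycDist_nonneg (a : ImagTimeIdx M) : 0 ≤ min ((a : ℕ) : ℝ) (((2 * M : ℕ) : ℝ) - (a : ℕ)) := by
  apply le_min (by positivity)
  have : ((a : ℕ) : ℝ) < ((2 * M : ℕ) : ℝ) := by exact_mod_cast a.isLt
  linarith

/-! ## §2 Leg sums of a function of the leg variable -/

/-- Summing ANY function of the leg variable `w = ±(u+σ)` over the leg's own time `u` gives the full sum. -/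
theorem klct_sum_leg_fun_time (Φ : ImagTimeIdx M → ℝ) (e : Fin 2) (σ : ImagTimeIdx M) :
    ∑ u : ImagTimeIdx M, Φ ((if e = 0 then u + σ else -(u + σ) : ImagTimeIdx M)) = ∑ j : ImagTimeIdx M, Φ j := by
  by_cases he : e = 0
  · simp only [he, if_true]
    exact Fintype.sum_bijective (fun u : ImagTimeIdx M => u + σ) (Equiv.addRight σ).bijective _ _ (fun _ => rfl)
  · simp only [he, if_false]
    exact Fintype.sum_bijective (fun u : ImagTimeIdx M => -(u + σ)) ((Equiv.addRight σ).trans (Equiv.neg _)).bijective _ _ (fun _ => rfl)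

/-- …and over the auxiliary time `σ` at fixed `u`. -/
theorem klct_sum_leg_fun_aux (Φ : ImagTimeIdx M → ℝ) (e : Fin 2) (u : ImagTimeIdx M) :
    ∑ σ : ImagTimeIdx M, Φ ((if e = 0 then u + σ else -(u + σ) : ImagTimeIdx M)) = ∑ j : ImagTimeIdx M, Φ j := by
  by_cases he : e = 0
  · simp only [he, if_true]
    exact Fintype.sum_bijective (fun σ : ImagTimeIdx M => u + σ) (Equiv.addLeft u).bijective _ _ (fun _ => rfl)
  · simp only [he, if_false]
    exact Fintype.sum_bijective (fun σ : ImagTimeIdx M => -(u + σ)) ((Equiv.addLeft u).trans (Equiv.neg _)).bijective _ _ (fun _ => rfl)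

omit [NeZero M] in
/-- **A pinned product sum with ONE weighted leg**: for `F_k, φ ≥ 0`-free reals,
`Σ_{t : t_q = y₀} φ(t_i) ∏_k F_k(t_k) = G_q(y₀) · ∏_{k ≠ q} Σ_u G_k(u)` with `G_k = F_k` for `k ≠ i` and `G_i = φ·F_i`. -/
theorem klct_sum_pinned_prod_weighted (F : Fin 4 → ImagTimeIdx M → ℝ) (φ : ImagTimeIdx M → ℝ) (i q : Fin 4) (y₀ : ImagTimeIdx M) :
    ∑ t ∈ univ.filter (fun t : Fin 4 → ImagTimeIdx M => t q = y₀), φ (t i) * ∏ k : Fin 4, F k (t k) =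
      (fun k u => (if k = i then φ u else 1) * F k u) q y₀ * ∏ k ∈ univ.erase q, ∑ u : ImagTimeIdx M, (fun k u => (if k = i then φ u else 1) * F k u) k u := by
  rw [← klct_sum_pinned_prod (fun k u => (if k = i then φ u else 1) * F k u) q y₀]
  refine Finset.sum_congr rfl (fun t _ => ?_)
  rw [Finset.prod_mul_distrib, Finset.prod_ite_eq' univ i (fun k => φ (t k)), if_pos (Finset.mem_univ _)]

/-! ## §3 THE FIRST-MOMENT FACTORISATION -/

/-- **FIRST-MOMENT (TREE-WEIGHT) FACTORISATION** (`β ≠ 0`, leg weight `c` supported in `4|n′| < 2M`, pinned leg `q`, pin `y₀`; `N = 2M`):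
`Σ_{t : t_q = y₀} (Σ_i d_N(t_i − y₀)) · |Σ_{n : n′₀+n′₂ = n′₁+n′₃} (∏ c(n_i)) ∏ e^{−is_iω_{n_i}τ_{t_i}}| ≤ 8 · N⁻¹ · Mom(c) · Mass(c)³`,
`Mass(c) = Σ_j |Σ_v c(v) e^{−2πivj/N}|`, `Mom(c) = Σ_j d_N(j)·|Σ_v c(v) e^{−2πivj/N}|`. -/
theorem klct_pinnedTimeSum_firstMoment_le {β : ℝ} (hβ : β ≠ 0) (c : MatsubaraIdx M → ℂ)
    (hc : ∀ n : MatsubaraIdx M, c n ≠ 0 → (4 : ℤ) * |matsubaraInt M n| < 2 * M) (q : Fin 4) (y₀ : ImagTimeIdx M) :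
    ∑ t ∈ univ.filter (fun t : Fin 4 → ImagTimeIdx M => t q = y₀),
        (∑ i : Fin 4, min ((((t i - y₀ : ImagTimeIdx M)) : ℕ) : ℝ) (((2 * M : ℕ) : ℝ) - (((t i - y₀ : ImagTimeIdx M)) : ℕ))) *
          ‖∑ n : Fin 4 → MatsubaraIdx M,
              if matsubaraInt M (n 0) + matsubaraInt M (n 2) = matsubaraInt M (n 1) + matsubaraInt M (n 3) then
                (∏ i : Fin 4, c (n i)) * ∏ i : Fin 4, Complex.exp (-((chargeSign ((![(((0 : Fin 1), (0 : Fin 2)), (0 : Fin 2)), ((0, 0), 1), ((0, 1), 0), ((0, 1), 1)] : Fin 4 → SectorLeg 1) i).2 * (matsubaraFreq β M (n i) * imagTime β M (t i)) : ℝ) : ℂ) * Complex.I)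
              else 0‖ ≤
      8 * (((2 * M : ℕ) : ℝ))⁻¹ *
        (∑ j : ImagTimeIdx M, min ((j : ℕ) : ℝ) (((2 * M : ℕ) : ℝ) - (j : ℕ)) *
          ‖∑ n : MatsubaraIdx M, c n * Complex.exp (-((2 * Real.pi * ((n : ℕ) : ℝ) * ((j : ℕ) : ℝ) / (2 * M) : ℝ) : ℂ) * Complex.I)‖) *
        (∑ j : ImagTimeIdx M, ‖∑ n : MatsubaraIdx M, c n * Complex.exp (-((2 * Real.pi * ((n : ℕ) : ℝ) * ((j : ℕ) : ℝ) / (2 * M) : ℝ) : ℂ) * Complex.I)‖) ^ 3 := by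
  have hN0 : 0 < ((2 * M : ℕ) : ℝ) := by have := NeZero.ne M; exact_mod_cast (by omega : 0 < 2 * M)
  -- names
  set dN : ImagTimeIdx M → ℝ := fun a => min ((a : ℕ) : ℝ) (((2 * M : ℕ) : ℝ) - (a : ℕ)) with hdN
  set LT : ImagTimeIdx M → ℂ := fun j => ∑ n : MatsubaraIdx M, c n * Complex.exp (-((2 * Real.pi * ((n : ℕ) : ℝ) * ((j : ℕ) : ℝ) / (2 * M) : ℝ) : ℂ) * Complex.I)
    with hLT
  set Mass : ℝ := ∑ j : ImagTimeIdx M, ‖LT j‖ with hMass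
  set Mom : ℝ := ∑ j : ImagTimeIdx M, dN j * ‖LT j‖ with hMom
  set w : Fin 4 → ImagTimeIdx M → ImagTimeIdx M → ImagTimeIdx M := fun i u σ => if (![(0 : Fin 2), 1, 0, 1] i) = 0 then u + σ else -(u + σ) with hw
  set G : Fin 4 → ImagTimeIdx M → ImagTimeIdx M → ℂ := fun i u σ =>
      ∑ v : MatsubaraIdx M, c v * Complex.exp (-((chargeSign (![(0 : Fin 2), 1, 0, 1] i) * (matsubaraFreq β M v * imagTime β M u) : ℝ) : ℂ) * Complex.I) *
        Complex.exp (-((2 * Real.pi * chargeSign (![(0 : Fin 2), 1, 0, 1] i) * (matsubaraInt M v : ℝ) * ((σ : ℕ) : ℝ) / (2 * M) : ℝ) : ℂ) * Complex.I) with hGdef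
  have hMass0 : 0 ≤ Mass := Finset.sum_nonneg (fun _ _ => norm_nonneg _)
  have hdN0 : ∀ a, 0 ≤ dN a := fun a => klct_cycDist_nonneg a
  have hMom0 : 0 ≤ Mom := Finset.sum_nonneg (fun j _ => mul_nonneg (hdN0 j) (norm_nonneg _))
  -- the leg modulus is a function of the leg variable
  have hGw : ∀ i u σ, ‖G i u σ‖ = ‖LT (w i u σ)‖ := fun i u σ => klct_leg_norm_eq hβ c _ u σ
  -- leg sums (plain and weighted), over `u` and over `σ`
  have hlegT : ∀ i σ, ∑ u : ImagTimeIdx M, ‖G i u σ‖ = Mass := by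
    intro i σ; simp_rw [hGw]; exact klct_sum_leg_fun_time (fun j => ‖LT j‖) _ σ
  have hlegA : ∀ i u, ∑ σ : ImagTimeIdx M, ‖G i u σ‖ = Mass := by
    intro i u; simp_rw [hGw]; exact klct_sum_leg_fun_aux (fun j => ‖LT j‖) _ u
  have hlegTw : ∀ i σ, ∑ u : ImagTimeIdx M, dN (w i u σ) * ‖G i u σ‖ = Mom := by
    intro i σ; simp_rw [hGw]; exact klct_sum_leg_fun_time (fun j => dN j * ‖LT j‖) _ σ
  have hlegAw : ∀ i u, ∑ σ : ImagTimeIdx M, dN (w i u σ) * ‖G i u σ‖ = Mom := by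
    intro i u; simp_rw [hGw]; exact klct_sum_leg_fun_aux (fun j => dN j * ‖LT j‖) _ u
  -- pointwise: `|T(t)| ≤ N⁻¹ Σ_σ ∏ |G_i(t_i,σ)|`
  have hpt : ∀ t : Fin 4 → ImagTimeIdx M,
      ‖∑ n : Fin 4 → MatsubaraIdx M,
          if matsubaraInt M (n 0) + matsubaraInt M (n 2) = matsubaraInt M (n 1) + matsubaraInt M (n 3) then
            (∏ i : Fin 4, c (n i)) * ∏ i : Fin 4, Complex.exp (-((chargeSign ((![(((0 : Fin 1), (0 : Fin 2)), (0 : Fin 2)), ((0, 0), 1), ((0, 1), 0), ((0, 1), 1)] : Fin 4 → SectorLeg 1) i).2 * (matsubaraFreq β M (n i) * imagTime β M (t i)) : ℝ) : ℂ) * Complex.I)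
          else 0‖ ≤ (((2 * M : ℕ) : ℝ))⁻¹ * ∑ σ : ImagTimeIdx M, ∏ i : Fin 4, ‖G i (t i) σ‖ := by
    intro t
    rw [klct_timeSum_eq_aux_sum β c hc t, norm_mul, norm_inv, Complex.norm_natCast]
    gcongr
    refine (norm_sum_le _ _).trans (le_of_eq ?_)
    refine Finset.sum_congr rfl (fun σ _ => ?_)
    rw [norm_prod]
  -- the weight through the auxiliary time
  have hWt : ∀ (t : Fin 4 → ImagTimeIdx M) (σ : ImagTimeIdx M), t q = y₀ →
      ∑ i : Fin 4, dN (t i - y₀) ≤ ∑ i : Fin 4, (dN (w i (t i) σ) + dN (w q y₀ σ)) := by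
    intro t σ ht
    refine Finset.sum_le_sum (fun i _ => ?_)
    exact klct_cycDist_sub_le (t i) y₀ σ (![(0 : Fin 2), 1, 0, 1] i) (![(0 : Fin 2), 1, 0, 1] q)
  -- for fixed `σ` and `i`: the two pinned product sums
  have hP1 : ∀ (σ : ImagTimeIdx M) (i : Fin 4),
      ∑ t ∈ univ.filter (fun t : Fin 4 → ImagTimeIdx M => t q = y₀), dN (w i (t i) σ) * ∏ k : Fin 4, ‖G k (t k) σ‖ ≤
        (if i = q then dN (w q y₀ σ) * ‖G q y₀ σ‖ * Mass ^ 3 else ‖G q y₀ σ‖ * Mom * Mass ^ 2) := by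
    intro σ i
    rw [klct_sum_pinned_prod_weighted (fun k u => ‖G k u σ‖) (fun u => dN (w i u σ)) i q y₀]
    refine le_of_eq ?_
    by_cases hiq : i = q
    · subst hiq
      rw [if_pos rfl]
      simp only [if_true]
      congr 1
      have : ∀ k ∈ univ.erase i, ∑ u : ImagTimeIdx M, (if k = i then dN (w i u σ) else 1) * ‖G k u σ‖ = Mass := by
        intro k hk
        have hki : k ≠ i := Finset.ne_of_mem_erase hk
        simp only [hki, if_false, one_mul]
        exact hlegT k σ
      rw [Finset.prod_congr rfl this, Finset.prod_const, Finset.card_erase_of_mem (Finset.mem_univ _)]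
      simp
    · rw [if_neg hiq]
      simp only [show ¬ (q = i) from fun h => hiq h.symm, if_false, one_mul]
      have hi : i ∈ univ.erase q := Finset.mem_erase.mpr ⟨hiq, Finset.mem_univ _⟩
      rw [← Finset.mul_prod_erase _ _ hi]
      simp only [if_true]
      rw [hlegTw i σ]
      have : ∀ k ∈ (univ.erase q).erase i, ∑ u : ImagTimeIdx M, (if k = i then dN (w i u σ) else 1) * ‖G k u σ‖ = Mass := by
        intro k hk
        have hki : k ≠ i := Finset.ne_of_mem_erase hk
        simp only [hki, if_false, one_mul]
        exact hlegT k σ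
      rw [Finset.prod_congr rfl this, Finset.prod_const, Finset.card_erase_of_mem hi, Finset.card_erase_of_mem (Finset.mem_univ _)]
      simp
      ring
  have hP2 : ∀ (σ : ImagTimeIdx M),
      ∑ t ∈ univ.filter (fun t : Fin 4 → ImagTimeIdx M => t q = y₀), ∏ k : Fin 4, ‖G k (t k) σ‖ = ‖G q y₀ σ‖ * Mass ^ 3 := by
    intro σ
    rw [klct_sum_pinned_prod (fun k u => ‖G k u σ‖) q y₀]
    congr 1
    rw [Finset.prod_congr rfl (fun k _ => hlegT k σ), Finset.prod_const, Finset.card_erase_of_mem (Finset.mem_univ q)]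
    simp
  -- sum over `σ` of the per-`i` bound: `2·Mom·Mass³` in both cases
  have hσsum : ∀ i : Fin 4,
      ∑ σ : ImagTimeIdx M, ((if i = q then dN (w q y₀ σ) * ‖G q y₀ σ‖ * Mass ^ 3 else ‖G q y₀ σ‖ * Mom * Mass ^ 2) +
        dN (w q y₀ σ) * (‖G q y₀ σ‖ * Mass ^ 3)) = 2 * Mom * Mass ^ 3 := by
    intro i
    rw [Finset.sum_add_distrib]
    have h2 : ∑ σ : ImagTimeIdx M, dN (w q y₀ σ) * (‖G q y₀ σ‖ * Mass ^ 3) = Mom * Mass ^ 3 := by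
      rw [← hlegAw q y₀, Finset.sum_mul]
      exact Finset.sum_congr rfl (fun σ _ => by ring)
    by_cases hiq : i = q
    · simp only [hiq, if_true]
      have h1 : ∑ σ : ImagTimeIdx M, dN (w q y₀ σ) * ‖G q y₀ σ‖ * Mass ^ 3 = Mom * Mass ^ 3 := by
        rw [← hlegAw q y₀, Finset.sum_mul]
      rw [h1, h2]; ring
    · simp only [hiq, if_false]
      have h1 : ∑ σ : ImagTimeIdx M, ‖G q y₀ σ‖ * Mom * Mass ^ 2 = Mass * Mom * Mass ^ 2 := by
        rw [← hlegA q y₀, Finset.sum_mul, Finset.sum_mul]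
      rw [h1, h2]; ring
  -- ASSEMBLY
  set F := univ.filter (fun t : Fin 4 → ImagTimeIdx M => t q = y₀) with hF
  set P : (Fin 4 → ImagTimeIdx M) → ImagTimeIdx M → ℝ := fun t σ => ∏ k : Fin 4, ‖G k (t k) σ‖ with hP
  have hP0 : ∀ t σ, 0 ≤ P t σ := fun t σ => Finset.prod_nonneg (fun _ _ => norm_nonneg _)
  have hW0 : ∀ t : Fin 4 → ImagTimeIdx M, 0 ≤ ∑ i : Fin 4, dN (t i - y₀) := fun t => Finset.sum_nonneg (fun i _ => hdN0 _)
  -- step 1: the modulus bound, termwise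
  have step1 : ∑ t ∈ F, (∑ i : Fin 4, dN (t i - y₀)) * ‖∑ n : Fin 4 → MatsubaraIdx M,
          if matsubaraInt M (n 0) + matsubaraInt M (n 2) = matsubaraInt M (n 1) + matsubaraInt M (n 3) then
            (∏ i : Fin 4, c (n i)) * ∏ i : Fin 4, Complex.exp (-((chargeSign ((![(((0 : Fin 1), (0 : Fin 2)), (0 : Fin 2)), ((0, 0), 1), ((0, 1), 0), ((0, 1), 1)] : Fin 4 → SectorLeg 1) i).2 * (matsubaraFreq β M (n i) * imagTime β M (t i)) : ℝ) : ℂ) * Complex.I)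
          else 0‖ ≤ ∑ t ∈ F, (∑ i : Fin 4, dN (t i - y₀)) * ((((2 * M : ℕ) : ℝ))⁻¹ * ∑ σ : ImagTimeIdx M, P t σ) :=
    Finset.sum_le_sum (fun t _ => mul_le_mul_of_nonneg_left (hpt t) (hW0 t))
  -- step 2: exchange the sums
  have step2 : ∑ t ∈ F, (∑ i : Fin 4, dN (t i - y₀)) * ((((2 * M : ℕ) : ℝ))⁻¹ * ∑ σ : ImagTimeIdx M, P t σ) =
      (((2 * M : ℕ) : ℝ))⁻¹ * ∑ σ : ImagTimeIdx M, ∑ t ∈ F, (∑ i : Fin 4, dN (t i - y₀)) * P t σ := by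
    symm
    rw [Finset.sum_comm, Finset.mul_sum]
    refine Finset.sum_congr rfl (fun t _ => ?_)
    simp only [Finset.mul_sum]
    exact Finset.sum_congr rfl (fun σ _ => by ring)
  -- step 3: the weight through the auxiliary time
  have step3 : ∀ σ : ImagTimeIdx M, ∑ t ∈ F, (∑ i : Fin 4, dN (t i - y₀)) * P t σ ≤
      ∑ t ∈ F, (∑ i : Fin 4, (dN (w i (t i) σ) + dN (w q y₀ σ))) * P t σ := by
    intro σ
    refine Finset.sum_le_sum (fun t ht => ?_)
    exact mul_le_mul_of_nonneg_right (hWt t σ (Finset.mem_filter.mp ht).2) (hP0 t σ)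
  -- step 4: expand
  have step4 : ∀ σ : ImagTimeIdx M, ∑ t ∈ F, (∑ i : Fin 4, (dN (w i (t i) σ) + dN (w q y₀ σ))) * P t σ =
      ∑ i : Fin 4, (∑ t ∈ F, dN (w i (t i) σ) * P t σ + dN (w q y₀ σ) * ∑ t ∈ F, P t σ) := by
    intro σ
    simp only [Finset.sum_mul, add_mul, Finset.mul_sum, ← Finset.sum_add_distrib]
    rw [Finset.sum_comm]
  -- step 5: the two pinned product sums
  have step5 : ∀ σ : ImagTimeIdx M, ∑ i : Fin 4, (∑ t ∈ F, dN (w i (t i) σ) * P t σ + dN (w q y₀ σ) * ∑ t ∈ F, P t σ) ≤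
      ∑ i : Fin 4, ((if i = q then dN (w q y₀ σ) * ‖G q y₀ σ‖ * Mass ^ 3 else ‖G q y₀ σ‖ * Mom * Mass ^ 2) +
        dN (w q y₀ σ) * (‖G q y₀ σ‖ * Mass ^ 3)) := by
    intro σ
    refine Finset.sum_le_sum (fun i _ => add_le_add (hP1 σ i) (le_of_eq ?_))
    rw [hP2 σ]
  -- step 6: collect
  have step6 : ∑ σ : ImagTimeIdx M, ∑ i : Fin 4, ((if i = q then dN (w q y₀ σ) * ‖G q y₀ σ‖ * Mass ^ 3 else ‖G q y₀ σ‖ * Mom * Mass ^ 2) +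
        dN (w q y₀ σ) * (‖G q y₀ σ‖ * Mass ^ 3)) = 8 * Mom * Mass ^ 3 := by
    rw [Finset.sum_comm, Finset.sum_congr rfl (fun i _ => hσsum i), Finset.sum_const, Finset.card_univ, Fintype.card_fin]
    simp only [nsmul_eq_mul, Nat.cast_ofNat]
    ring
  have hchain : ∑ σ : ImagTimeIdx M, ∑ t ∈ F, (∑ i : Fin 4, dN (t i - y₀)) * P t σ ≤ 8 * Mom * Mass ^ 3 := by
    rw [← step6]
    exact Finset.sum_le_sum (fun σ _ => (step3 σ).trans ((step4 σ).le.trans (step5 σ)))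
  calc _ ≤ _ := step1
    _ = _ := step2
    _ ≤ (((2 * M : ℕ) : ℝ))⁻¹ * (8 * Mom * Mass ^ 3) := mul_le_mul_of_nonneg_left hchain (inv_nonneg.mpr hN0.le)
    _ = _ := by ring

end Summit.HubbardSuperconductivity.HubbardSuperconductivity.Theorems.KLRegimeSplit

end
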